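import Literature.IUT.HodgeArakelov.ThetaEnvDataRecordAut
import Literature.IUT.HodgeArakelov.EtaleThetaDataOfSettingAutAction

/-!
# [IUTchII] Prop 3.4 (i) at the GENUINE data with the Π-INTRINSIC `Aut(Π^tp_{X̲̲})`-action: binder (P1) of
# `prop34i_multiradiallyDefined_genuine` discharged to {[EtTh] Cor 2.18 (i) (F-0620), `hq`}

S. Mochizuki, *Inter-universal Teichmüller theory II*, kurims manuscript (Dec. 2020), §3, Prop 3.4 (i), pp. 91–92
[cite: Mochizuki2012, Prop 3.4 (i) p.91]: "Each isomorphism of projective systems of mono-theta environments …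
induces compatible collections of isomorphisms …; the left-hand square in each diagram arises from the functoriality
of the algorithms involved …; the functorial algorithms `Π_v ↦ Ψ_env(M^Θ_*(Π_v))`; `Π_v ↦ ∞Ψ_env(M^Θ_*(Π_v))` … are
compatible … in the sense that the natural functor `Ψ_ℛ` of Corollary 1.12, (iii), is multiradially defined."  Claim
key DISPUTED (D-0012).  [EtTh] Cor. 2.18 (i) p. 60 (refereed): FACT-LIST F-0620 `RigidData.Cor218_i`, BY NAME.
abc-iut cell, layer L6, WAVE-5 seat abc-iut-w5-d169 (holder of `plan/L6/SUBDAG-IUTchII-Prop-31-33-34.md`), holder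
sub-row «P34i-GENUINE-(P1)» (L6-lead §F v1.19s); no side taken on [IUTchIII] Cor 3.12.

WHAT CHANGES with respect to abc-iut-w5-d169's `ThetaEnvDataRecordAut.lean` (p423712).  There, the action of
`α ∈ Aut_top(Π^tp_{X̲̲})` on `lim_J H¹(Π^tp_{Ÿ̲̲} ∩ J, l·Δ_Θ)` was abc-iut-w5-d072's PAIR action for the DATA binder (P1)
`AutCompanion C` (a homomorphic choice of companions `β(α)` on the WHOLE `(Π^tp_X)^Θ`) — not instantiable, since
`φ(Π^tp_{X̲̲}) ⊊ (Π^tp_X)^Θ`.  HERE the action is the Π-INTRINSIC `EtaleThetaDataOfSetting.autActOfCor218i`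
(`EtaleThetaDataOfSettingAutAction.lean`): transport along `(α, rangeAut α)` at the ambient `φ(Π^tp_{X̲̲}) ≅ Π^tp_{X̲̲}/Ker φ`
— print's "certain subquotient `(l·Δ_Θ)(Π)` of `Π`" (Prop 1.4 p. 27) — whose inputs are the three clauses of the
named FACT [EtTh] Cor. 2.18 (i) at abc-iut-L2-t8's `C.rigidData` and abc-iut-w5-d072's interface-topology hypothesis
`hq : IsQuotientMap D.toTheta`.  Sections 3–5 of p423712 are re-assembled VERBATIM over this action:
* `orbitEquivI` — conjugation of the inversion orbit by the action (INPUT (P2) `hρ`, now purely about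
  `Aut_top(Π^tp_{X̲̲})`: the action of `α` conjugates `ρ` into its `Π^tp_{X̲̲}`-orbit — [IUTchII] Prop 2.2 (i) class);
* `recordIsoOfI` / **`autIsoActionOrbitI : AutIsoAction (thetaEnvRecordOrbit κ ρ)`** — functorial by
  `autActOfCor218i_refl/_trans`, equivariant by `autActOfCor218i_conj`; (P3) `hκ` (Kummer image stable, [AbsTopIII] §3
  class) and (P4) `hθ`/`hinf` (theta classes stable, [EtTh] Cor. 2.19 (iii) constant-multiple-rigidity class) stay
  binders, restated for the intrinsic action;
* `thetaEnvTransportI`, **`prop34i_multiradiallyDefined_intrinsic`** — [IUTchII] Prop 3.4 (i) multiradiality AT THE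
  GENUINE FUNCTOR with (P1) GONE.
HONEST RESIDUAL after this file: F-0620 (named FACT), `hq` (interface topology), (P2) `hρ`, (P3) `hκ`, (P4) `hθ`/`hinf`,
plus the record's own standing inputs (`hcharY` = F-0620's `Π^tp_Ÿ`-clause by abc-iut-w4-d013, `hZ`, `hlim`, …).
Everything is CONSTRUCTED/PROVED over the landed files; no `Prop` is defined; nothing of [IUTchII] is asserted.
-/

noncomputable section

open Topology

namespace Literature.IUT.HodgeArakelov

open Literature.AnabelianGeometry.EtaleTheta Literature.AnabelianGeometry.SemiGraphs
open CohomologySystemOfContH1 EtaleThetaDataOfSetting TemperedThetaMonoids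
open scoped Literature.AnabelianGeometry.EtaleTheta

/-! ### 0. Generic: unit groups of stable submonoids are stable -/

/-- If a multiplicative automorphism carries a submonoid onto itself, it carries its unit group (abc-iut-w4-d019's
`unitsOfSubmonoid`) onto itself (local copy of the private helper of p423712). [folklore] -/
private theorem unitsOfSubmonoid_map_eq' {H : Type} [CommGroup H] (S : Submonoid H) (e : H ≃* H)
    (h : S.map (e : H →* H) = S) : (unitsOfSubmonoid S).map (e : H →* H) = unitsOfSubmonoid S := by
  have hmem : ∀ x, x ∈ S → e x ∈ S := fun x hx => by
    rw [← h]; exact ⟨x, hx, rfl⟩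
  have hmem' : ∀ y, y ∈ S → e.symm y ∈ S := fun y hy => by
    rw [← h] at hy
    obtain ⟨x, hx, hxy⟩ := hy
    have : e.symm y = x := by rw [← hxy]; exact e.symm_apply_apply x
    rw [this]; exact hx
  ext y
  constructor
  · rintro ⟨x, ⟨hx, hx'⟩, rfl⟩
    exact ⟨hmem x hx, by rw [MonoidHom.coe_coe, ← map_inv]; exact hmem _ hx'⟩
  · rintro ⟨hy, hy'⟩
    refine ⟨e.symm y, ⟨hmem' y hy, ?_⟩, by simp⟩
    rw [← map_inv]; exact hmem' _ hy'

namespace EtaleLevels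

variable {p : ℕ} [Fact p.Prime] {D : Literature.AnabelianGeometry.EtaleTheta.ThetaSetting p}
  {E : D.EtaleThetaData} {l : ℕ} (C : E.DoubleUnderline l) (hC : D.Compat) (hS : D.Sec2Hyps)
  (hl : l.Prime) (hp2 : p ≠ 2) (hpl : p ≠ l) (hζ : ∃ ζ : D.K, IsPrimitiveRoot ζ (4 * l))
  (mods : ∀ M : ℕ+, D.CyclotomeMod l M)
  (f : contCocycles D.toTheta D.DeltaTheta C.GtpYdduu) (hf : f ∈ C.rootCocycles hC)
  (hmods : ∀ (M M' : ℕ+) (h : (M : ℕ) ∣ (M' : ℕ)) (x : D.lDeltaTheta l),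
    MuN.red p M M' h ((mods M').red x) = (mods M).red x)
  (h15 : Literature.AnabelianGeometry.EtaleTheta.ThetaSetting.Prop15iii E hC) (L : C.CuspLabels)
  (hZ : ∀ M : ℕ+, Nonempty (ModelCyclotomes.lDeltaQuot (C.rigidData (mods M) hC hS h15 L) ≃*
    Literature.IUT.HodgeTheaters.ZHat))
  (hcharY : EtaleThetaDataOfSetting.PiYddCharacteristic C)
  (hlim : Function.Bijective (rigidLimHom C hC hS hl hp2 hpl hζ mods f hf hmods h15 L hZ))
  [(EtaleThetaDataOfSetting.PiYdd C).Normal]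
  (hq : IsQuotientMap D.toTheta) {N : ℕ+} (μ : D.CyclotomeMod l N)
  (R : RigidData.{0} N l) (hR : R = C.rigidData μ hC hS h15 L) (h218i : R.Cor218_i)

/-! ### 3′. The orbit is permuted by CONJUGATION with the intrinsic action (INPUT (P2)) -/

section Orbit

variable (ρ : h1Lim (phi C) (D.lDeltaTheta l) (PiYdd C) ⊥ ≃+ h1Lim (phi C) (D.lDeltaTheta l) (PiYdd C) ⊥)
  (hρ : ∀ α : (Pi C) ≃ₜ* (Pi C), ∃ c : Pi C, ∀ x,
    autActOfCor218i C hq μ hC hS h15 L R hR h218i α (ρ x) =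
      h1LimConj (phi C) (D.lDeltaTheta l) (PiYdd C) c
        (ρ (h1LimConj (phi C) (D.lDeltaTheta l) (PiYdd C) c⁻¹ (autActOfCor218i C hq μ hC hS h15 L R hR h218i α x))))

include hρ in
/-- Conjugating an orbit element by the intrinsic action of `α` stays in the orbit (uses (P2) and the equivariance
`autActOfCor218i_conj`). [cite: Mochizuki2012, Prop 2.2 (i) p.66] -/
theorem conjActI_mem_inversionOrbit (α : (Pi C) ≃ₜ* (Pi C))
    {e : h1Lim (phi C) (D.lDeltaTheta l) (PiYdd C) ⊥ ≃+ h1Lim (phi C) (D.lDeltaTheta l) (PiYdd C) ⊥}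
    (he : e ∈ inversionOrbit C ρ) :
    ((autActOfCor218i C hq μ hC hS h15 L R hR h218i α).symm.trans
      (e.trans (autActOfCor218i C hq μ hC hS h15 L R hR h218i α))) ∈ inversionOrbit C ρ := by
  obtain ⟨h, hh⟩ := he
  obtain ⟨c, hc⟩ := hρ α
  refine ⟨α h * c, fun x => ?_⟩
  rw [AddEquiv.trans_apply, AddEquiv.trans_apply, hh, autActOfCor218i_conj, hc, autActOfCor218i_conj, map_inv,
    AddEquiv.apply_symm_apply, ← h1LimConj_mul_apply, ← h1LimConj_mul_apply, mul_inv_rev]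

include hρ in
/-- … and conjugating the other way (by the action of `α⁻¹`). [cite: Mochizuki2012, Prop 2.2 (i) p.66] -/
theorem conjActISymm_mem_inversionOrbit (α : (Pi C) ≃ₜ* (Pi C))
    {e : h1Lim (phi C) (D.lDeltaTheta l) (PiYdd C) ⊥ ≃+ h1Lim (phi C) (D.lDeltaTheta l) (PiYdd C) ⊥}
    (he : e ∈ inversionOrbit C ρ) :
    ((autActOfCor218i C hq μ hC hS h15 L R hR h218i α).trans
      (e.trans (autActOfCor218i C hq μ hC hS h15 L R hR h218i α).symm)) ∈ inversionOrbit C ρ := by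
  obtain ⟨h', hh'⟩ := conjActI_mem_inversionOrbit C hC hS h15 L hq μ R hR h218i ρ hρ α.symm he
  refine ⟨h', fun x => ?_⟩
  rw [← hh' x, AddEquiv.trans_apply, AddEquiv.trans_apply, AddEquiv.trans_apply, AddEquiv.trans_apply,
    autActOfCor218i_symm, autActOfCor218i_symm_symm]

/-- **The index matching induced by `α`**: conjugation of the inversion orbit by the intrinsic action, a bijection
of the orbit (inverse: conjugation by the action of `α⁻¹`). [cite: Mochizuki2012, Prop 3.4 (i) p.91] -/
def orbitEquivI (α : (Pi C) ≃ₜ* (Pi C)) : inversionOrbit C ρ ≃ inversionOrbit C ρ where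
  toFun ι := ⟨(autActOfCor218i C hq μ hC hS h15 L R hR h218i α).symm.trans
      (ι.1.trans (autActOfCor218i C hq μ hC hS h15 L R hR h218i α)),
    conjActI_mem_inversionOrbit C hC hS h15 L hq μ R hR h218i ρ hρ α ι.2⟩
  invFun ι := ⟨(autActOfCor218i C hq μ hC hS h15 L R hR h218i α).trans
      (ι.1.trans (autActOfCor218i C hq μ hC hS h15 L R hR h218i α).symm),
    conjActISymm_mem_inversionOrbit C hC hS h15 L hq μ R hR h218i ρ hρ α ι.2⟩
  left_inv ι := Subtype.ext (AddEquiv.ext fun x => by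
    change (autActOfCor218i C hq μ hC hS h15 L R hR h218i α).symm
        (autActOfCor218i C hq μ hC hS h15 L R hR h218i α
          (ι.1 ((autActOfCor218i C hq μ hC hS h15 L R hR h218i α).symm
            (autActOfCor218i C hq μ hC hS h15 L R hR h218i α x)))) = ι.1 x
    rw [AddEquiv.symm_apply_apply, AddEquiv.symm_apply_apply])
  right_inv ι := Subtype.ext (AddEquiv.ext fun x => by
    change autActOfCor218i C hq μ hC hS h15 L R hR h218i α
        ((autActOfCor218i C hq μ hC hS h15 L R hR h218i α).symm
          (ι.1 (autActOfCor218i C hq μ hC hS h15 L R hR h218i α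
            ((autActOfCor218i C hq μ hC hS h15 L R hR h218i α).symm x)))) = ι.1 x
    rw [AddEquiv.apply_symm_apply, AddEquiv.apply_symm_apply])

/-- The matched inversion intertwines the action: `ι'(ρ_α x) = ρ_α (ι x)`. [cite: Mochizuki2012, Prop 3.4 (i) p.91] -/
theorem orbitEquivI_apply_apply (α : (Pi C) ≃ₜ* (Pi C)) (ι : inversionOrbit C ρ)
    (x : h1Lim (phi C) (D.lDeltaTheta l) (PiYdd C) ⊥) :
    (orbitEquivI C hC hS h15 L hq μ R hR h218i ρ hρ α ι).1 (autActOfCor218i C hq μ hC hS h15 L R hR h218i α x) =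
      autActOfCor218i C hq μ hC hS h15 L R hR h218i α (ι.1 x) := by
  change autActOfCor218i C hq μ hC hS h15 L R hR h218i α
      (ι.1 ((autActOfCor218i C hq μ hC hS h15 L R hR h218i α).symm
        (autActOfCor218i C hq μ hC hS h15 L R hR h218i α x))) = _
  rw [AddEquiv.symm_apply_apply]

end Orbit

/-! ### 4′. The `AutIsoAction` on the genuine record, intrinsic form (J10) -/

section Action

variable {M : Type} [CommMonoid M]
  (κ : M →* Multiplicative (thetaEnvData C hC hS hl hp2 hpl hζ mods f hf hmods h15 L hZ hcharY hlim).cohEnv.lim)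
  (ρ : h1Lim (phi C) (D.lDeltaTheta l) (PiYdd C) ⊥ ≃+ h1Lim (phi C) (D.lDeltaTheta l) (PiYdd C) ⊥)
  (hρ : ∀ α : (Pi C) ≃ₜ* (Pi C), ∃ c : Pi C, ∀ x,
    autActOfCor218i C hq μ hC hS h15 L R hR h218i α (ρ x) =
      h1LimConj (phi C) (D.lDeltaTheta l) (PiYdd C) c
        (ρ (h1LimConj (phi C) (D.lDeltaTheta l) (PiYdd C) c⁻¹ (autActOfCor218i C hq μ hC hS h15 L R hR h218i α x))))
  (hκ : ∀ α : (Pi C) ≃ₜ* (Pi C),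
    (MonoidHom.mrange κ).map (AddEquiv.toMultiplicative (autActOfCor218i C hq μ hC hS h15 L R hR h218i α) :
      Multiplicative (h1Lim (phi C) (D.lDeltaTheta l) (PiYdd C) ⊥) →*
        Multiplicative (h1Lim (phi C) (D.lDeltaTheta l) (PiYdd C) ⊥)) = MonoidHom.mrange κ)
  (hθ : ∀ α : (Pi C) ≃ₜ* (Pi C), autActOfCor218i C hq μ hC hS h15 L R hR h218i α ''
    ((thetaEnvData C hC hS hl hp2 hpl hζ mods f hf hmods h15 L hZ hcharY hlim).D.coh.toLim ⊤ ''
      (thetaEnvData C hC hS hl hp2 hpl hζ mods f hf hmods h15 L hZ hcharY hlim).D.theta) =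
    (thetaEnvData C hC hS hl hp2 hpl hζ mods f hf hmods h15 L hZ hcharY hlim).D.coh.toLim ⊤ ''
      (thetaEnvData C hC hS hl hp2 hpl hζ mods f hf hmods h15 L hZ hcharY hlim).D.theta)
  (hinf : ∀ α : (Pi C) ≃ₜ* (Pi C), autActOfCor218i C hq μ hC hS h15 L R hR h218i α ''
    (thetaEnvData C hC hS hl hp2 hpl hζ mods f hf hmods h15 L hZ hcharY hlim).D.thetaInfty =
    (thetaEnvData C hC hS hl hp2 hpl hζ mods f hf hmods h15 L hZ hcharY hlim).D.thetaInfty)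

include hθ hinf in
/-- **The isomorphism of the genuine record ALONG `α`, intrinsic form**: module component = the intrinsic action
`ρ_α`; index component = conjugation of the inversion orbit; compatibility with the conjugation actions =
`autActOfCor218i_conj`; `M_TM = κ(𝒪^▷)` and `M^×_TM` by (P3); `θ^ι_env ↦ θ^{ι'}_env`, `∞θ^ι_env ↦ ∞θ^{ι'}_env` by
(P4) and abc-iut-w4-d019's bridge lemmas. [cite: Mochizuki2012, Prop 3.4 (i) p.91] -/
def recordIsoOfI (α : (Pi C) ≃ₜ* (Pi C)) :
    TemperedThetaMonoids.ThetaEnvData.Iso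
      (thetaEnvRecordOrbit C hC hS hl hp2 hpl hζ mods f hf hmods h15 L hZ hcharY hlim κ ρ)
      (thetaEnvRecordOrbit C hC hS hl hp2 hpl hζ mods f hf hmods h15 L hZ hcharY hlim κ ρ) where
  phi := α.toMulEquiv
  e := AddEquiv.toMultiplicative (autActOfCor218i C hq μ hC hS h15 L R hR h218i α)
  iota := orbitEquivI C hC hS h15 L hq μ R hR h218i ρ hρ α
  map_conj g x := by
    change Multiplicative.ofAdd (autActOfCor218i C hq μ hC hS h15 L R hR h218i α
        (h1LimConj (phi C) (D.lDeltaTheta l) (PiYdd C) g (Multiplicative.toAdd x))) =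
      Multiplicative.ofAdd (h1LimConj (phi C) (D.lDeltaTheta l) (PiYdd C) (α g)
        (autActOfCor218i C hq μ hC hS h15 L R hR h218i α (Multiplicative.toAdd x)))
    rw [autActOfCor218i_conj]
  map_units := unitsOfSubmonoid_map_eq' _ _ (hκ α)
  map_constants := hκ α
  image_thetaEnv ι := by
    change AddEquiv.toMultiplicative (autActOfCor218i C hq μ hC hS h15 L R hR h218i α) ''
        (thetaEnvData C hC hS hl hp2 hpl hζ mods f hf hmods h15 L hZ hcharY hlim).envSet
          ((thetaEnvData C hC hS hl hp2 hpl hζ mods f hf hmods h15 L hZ hcharY hlim).thetaIotaLim ι.1) =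
      (thetaEnvData C hC hS hl hp2 hpl hζ mods f hf hmods h15 L hZ hcharY hlim).envSet
        ((thetaEnvData C hC hS hl hp2 hpl hζ mods f hf hmods h15 L hZ hcharY hlim).thetaIotaLim
          (orbitEquivI C hC hS h15 L hq μ R hR h218i ρ hρ α ι).1)
    refine (ThetaEnvData.image_envSet_of_compat (thetaEnvData C hC hS hl hp2 hpl hζ mods f hf hmods h15 L hZ hcharY hlim)
      (AddEquiv.toMultiplicative (autActOfCor218i C hq μ hC hS h15 L R hR h218i α))
      (autActOfCor218i C hq μ hC hS h15 L R hR h218i α) (fun x => rfl) _).trans ?_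
    exact congrArg (thetaEnvData C hC hS hl hp2 hpl hζ mods f hf hmods h15 L hZ hcharY hlim).envSet
      (ThetaEnvData.image_iotaInvariants_of_conj (thetaEnvData C hC hS hl hp2 hpl hζ mods f hf hmods h15 L hZ hcharY hlim)
        (autActOfCor218i C hq μ hC hS h15 L R hR h218i α) ι.1
        (orbitEquivI C hC hS h15 L hq μ R hR h218i ρ hρ α ι).1
        (orbitEquivI_apply_apply C hC hS h15 L hq μ R hR h218i ρ hρ α ι) (hθ α))
  image_inftyThetaEnv ι := by
    change AddEquiv.toMultiplicative (autActOfCor218i C hq μ hC hS h15 L R hR h218i α) ''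
        (thetaEnvData C hC hS hl hp2 hpl hζ mods f hf hmods h15 L hZ hcharY hlim).envSet
          ((thetaEnvData C hC hS hl hp2 hpl hζ mods f hf hmods h15 L hZ hcharY hlim).thetaInftyIotaLim ι.1) =
      (thetaEnvData C hC hS hl hp2 hpl hζ mods f hf hmods h15 L hZ hcharY hlim).envSet
        ((thetaEnvData C hC hS hl hp2 hpl hζ mods f hf hmods h15 L hZ hcharY hlim).thetaInftyIotaLim
          (orbitEquivI C hC hS h15 L hq μ R hR h218i ρ hρ α ι).1)
    refine (ThetaEnvData.image_envSet_of_compat (thetaEnvData C hC hS hl hp2 hpl hζ mods f hf hmods h15 L hZ hcharY hlim)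
      (AddEquiv.toMultiplicative (autActOfCor218i C hq μ hC hS h15 L R hR h218i α))
      (autActOfCor218i C hq μ hC hS h15 L R hR h218i α) (fun x => rfl) _).trans ?_
    exact congrArg (thetaEnvData C hC hS hl hp2 hpl hζ mods f hf hmods h15 L hZ hcharY hlim).envSet
      (ThetaEnvData.image_iotaInvariants_of_conj (thetaEnvData C hC hS hl hp2 hpl hζ mods f hf hmods h15 L hZ hcharY hlim)
        (autActOfCor218i C hq μ hC hS h15 L R hR h218i α) ι.1
        (orbitEquivI C hC hS h15 L hq μ R hR h218i ρ hρ α ι).1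
        (orbitEquivI_apply_apply C hC hS h15 L hq μ R hR h218i ρ hρ α ι) (hinf α))

/-- **J10 at the genuine data with the INTRINSIC action — the `Aut(Π^tp_{X̲̲_k})`-action on the Prop 3.1 record by
isomorphisms** (`TemperedThetaMonoids.ThetaEnvData.AutIsoAction`), FUNCTORIAL: identity ↦ identity and composite ↦
composite on the module (`autActOfCor218i_refl/_trans`) and on the inversion orbit (conjugation by a homomorphic
action). [cite: Mochizuki2012, Prop 3.4 (i) p.91] -/
def autIsoActionOrbitI :
    TemperedThetaMonoids.ThetaEnvData.AutIsoAction
      (thetaEnvRecordOrbit C hC hS hl hp2 hpl hζ mods f hf hmods h15 L hZ hcharY hlim κ ρ) where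
  iso α := recordIsoOfI C hC hS hl hp2 hpl hζ mods f hf hmods h15 L hZ hcharY hlim hq μ R hR h218i κ ρ hρ hκ hθ hinf α
  iso_phi _ _ := rfl
  iso_refl_e x := congrArg Multiplicative.ofAdd
    (autActOfCor218i_refl C hq μ hC hS h15 L R hR h218i (Multiplicative.toAdd x))
  iso_refl_iota ι := Subtype.ext (AddEquiv.ext fun x => by
    change autActOfCor218i C hq μ hC hS h15 L R hR h218i (ContinuousMulEquiv.refl _)
        (ι.1 ((autActOfCor218i C hq μ hC hS h15 L R hR h218i (ContinuousMulEquiv.refl _)).symm x)) = ι.1 x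
    rw [autActOfCor218i_refl]
    congr 1
    apply (autActOfCor218i C hq μ hC hS h15 L R hR h218i (ContinuousMulEquiv.refl _)).injective
    rw [AddEquiv.apply_symm_apply, autActOfCor218i_refl])
  iso_trans_e α₁ α₂ x := congrArg Multiplicative.ofAdd
    (autActOfCor218i_trans C hq μ hC hS h15 L R hR h218i α₁ α₂ (Multiplicative.toAdd x))
  iso_trans_iota α₁ α₂ ι := Subtype.ext (AddEquiv.ext fun x => by
    change autActOfCor218i C hq μ hC hS h15 L R hR h218i (α₁.trans α₂)
        (ι.1 ((autActOfCor218i C hq μ hC hS h15 L R hR h218i (α₁.trans α₂)).symm x)) =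
      autActOfCor218i C hq μ hC hS h15 L R hR h218i α₂ (autActOfCor218i C hq μ hC hS h15 L R hR h218i α₁
        (ι.1 ((autActOfCor218i C hq μ hC hS h15 L R hR h218i α₁).symm
          ((autActOfCor218i C hq μ hC hS h15 L R hR h218i α₂).symm x))))
    erw [autActOfCor218i_trans]
    congr 3
    apply (autActOfCor218i C hq μ hC hS h15 L R hR h218i (α₁.trans α₂)).injective
    erw [AddEquiv.apply_symm_apply, autActOfCor218i_trans, AddEquiv.apply_symm_apply, AddEquiv.apply_symm_apply])

/-- **The transport input of Prop 3.4 (i) at the genuine data, intrinsic form**: theta-environment data on EVERY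
isomorph of `Π^tp_{X̲̲}` functorially (`ThetaEnvTransport.ofAutAction` of the action above), over abc-iut-L6-d6's
[IUTchII] §1 setting `ThetaSetting.ofDoubleUnderline` (whose `Π^tp_{X̲̲_k}` IS `Pi C`). [cite: Mochizuki2012, Prop 3.4 (i) p.91] -/
def thetaEnvTransportI {η : (C.thetaEnvData μ hC hS).PiYdd → MuN p N} (hη : η ∈ (C.thetaEnvData μ hC hS).thetaCocycles) :
    TemperedThetaMonoids.ThetaEnvTransport (ThetaSetting.ofDoubleUnderline C μ hC hS hl hp2 hpl hζ hη) :=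
  TemperedThetaMonoids.ThetaEnvTransport.ofAutAction
    (S := ThetaSetting.ofDoubleUnderline C μ hC hS hl hp2 hpl hζ hη)
    (thetaEnvRecordOrbit C hC hS hl hp2 hpl hζ mods f hf hmods h15 L hZ hcharY hlim κ ρ)
    (autIsoActionOrbitI C hC hS hl hp2 hpl hζ mods f hf hmods h15 L hZ hcharY hlim hq μ R hR h218i κ ρ hρ hκ hθ hinf)

/-- **[IUTchII] Prop 3.4 (i) — MULTIRADIALITY OF SPLIT THETA MONOIDS AT THE GENUINE FUNCTOR, binder (P1) DISCHARGED**: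
the functor `Π_v ↦ (Π_v ↷ {Ψ^ι_env(𝕄_*(Π_v))}_ι, M^×_TM, Ψ_cns)` built from the NATURAL system of mono-theta
environments of `X̲̲_K`, transported along isomorphisms `Π_v ⥲ Π^tp_{X̲̲}` by the Π-INTRINSIC `Aut(Π^tp_{X̲̲})`-action
(inputs: the named FACT [EtTh] Cor. 2.18 (i) = F-0620 at `C.rigidData`, and `hq`), on the radial category of
Example 1.8 (iii)/(iv) IS multiradially defined — modulo the binders (P2) `hρ`, (P3) `hκ`, (P4) `hθ`/`hinf` only
(abc-iut-w5-d169's `prop34i_multiradiallyDefined`, itself abc-iut-L6-t1's `cor111_multiradiallyDefined`).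
[cite: Mochizuki2012, Prop 3.4 (i) p.92] -/
theorem prop34i_multiradiallyDefined_intrinsic
    {η : (C.thetaEnvData μ hC hS).PiYdd → MuN p N} (hη : η ∈ (C.thetaEnvData μ hC hS).thetaCocycles)
    (Γ : Type) [Group Γ] :
    ((ex18iii (ThetaSetting.ofDoubleUnderline C μ hC hS hl hp2 hpl hζ hη) Γ).toDagger
      (TemperedThetaMonoids.prop34iRadialFunctor
        (thetaEnvTransportI C hC hS hl hp2 hpl hζ mods f hf hmods h15 L hZ hcharY hlim hq μ R hR h218i κ ρ hρ hκ hθ hinf hη)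
        Γ)).IsMultiradiallyDefined :=
  TemperedThetaMonoids.prop34i_multiradiallyDefined _ Γ

end Action

end EtaleLevels

end Literature.IUT.HodgeArakelov

end
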